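import Summits.QuantumAdvantage.AdviceFreeQNC0.AffBells22SubcubeWalk
import HarnessLib

/-!
# Cell qa-qnc0 (route `DWalkThree`, face (M2), gap (G1) of planner qa-qnc0-p1's ROUND-21 §5.6–5.7):
# walk hardness on SUBCUBES — part 2/2: the restricted strategy lies in the full module; `walkHardAllSubcube`

qn-lit g24's answer to ask P-22h (HOME/qa-qnc0/INBOX 2026-08-28), kernel form, continued from
`AffBells22SubcubeWalk.lean` (authored by qn-lit g24, landed by the prover seat qn-prover-3 g12; statements VERBATIM from
Sketch22 §2e).  Here: the strategy restricted to the subcube `{u_W = a_W}` as a function of the free bits (`Subcube.fW`)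
lies in the FULL module of the free cube (`Subcube.fW_mem_fullSpan`), win/fail bookkeeping on the subcube
(`card_win_add_card_fail`, `card_win_ext_le`, `card_fibre_le`, `card_filter_merge_le`), and the assembly
**`walkHardAllSubcube : δ₀ < 1 → WalkHardAllSubcube δ₀`** with the SAME `θ = 1 − c` as `WalkHardAll`
(`c` from `failSet_ge_of_mem_fullSpan`) and `n₀ = n₀(C, δ₀)`.

WHAT THIS IS NOT: the ring-side (G1) `JuntaHardConditioned` (needs the odd-class transport fibrewise in `a`); separation NOT moved.
-/

noncomputable section

namespace Summit.QuantumAdvantage.AdviceFreeQNC0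

open Classical
open Finset Literature.Computability.MetaComplexity Literature.Computability.MetaComplexity.Smolensky
open F4
open AffBells22

namespace Subcube

variable {n : ℕ} (W : Finset (Fin n)) (a : Fin n → Bool)

/-! ### 3. The restricted strategy lies in the full module of the free cube -/

/-- The strategy's `𝔽₄`-function on the subcube, as a function of the free bits. -/
def fW (c : ℕ) (y : Fin (n + 1) → (Fin n → Bool) → Bool) (v : Fin (n - W.card) → Bool) : F4 :=
  stratFun c y (ext W a v)

/-- `f_W ∈ M_D(P_{n−|W|})` as soon as every cut table is a degree-`≤ D` function of the free bits. -/
theorem fW_mem_fullSpan {D : ℕ} (c : ℕ) (y : Fin (n + 1) → (Fin n → Bool) → Bool)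
    (hy : ∀ g, HasDeg (fun u => y g (subcubeMerge W a u)) D) :
    fW W a c y ∈ fullSpan (n - W.card) D := by
  have hdeg : ∀ g : Fin (n + 1), HasDeg (fun v => y g (ext W a v)) D := by
    intro g
    have h := hasDeg_comp_ext W a (hy g)
    have e : (fun v => y g (subcubeMerge W a (ext W a v))) = fun v => y g (ext W a v) := by
      funext v; rw [merge_ext]
    rw [e] at h
    exact h
  set K : Fin (n + 1) → F4 := fun g => ∏ i ∈ W, (if a i then ω ^ lett ((aPat g.val : Fin n → Bool) i) else 1)
    with hK
  have e : fW W a c y = ∑ g : Fin (n + 1),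
      ((ω ^ (c + g.val) * K g) • fun v => ιF (y g (ext W a v)) * chi (aPat (cut W g.val)) v) := by
    funext v
    unfold fW
    rw [stratFun_eq]
    simp only [Finset.sum_apply, Pi.smul_apply, smul_eq_mul]
    refine sum_congr rfl fun g _ => ?_
    rw [chi_aPat_ext]
    ring
  rw [e]
  exact Submodule.sum_mem _ fun g _ =>
    Submodule.smul_mem _ _ (polySpan_mul_chi_mem (iotaF_mem_polySpan (hdeg g)) (cut W g.val))

/-- Win and fail on the subcube are complementary: `#WIN + #FAIL(f_W) = 2^{n−|W|}`. -/
theorem card_win_add_card_fail (c : ℕ) (y : Fin (n + 1) → (Fin n → Bool) → Bool) :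
    (univ.filter fun v : Fin (n - W.card) → Bool => ringWinU c y (ext W a v) = true).card +
      (failSetOf (fW W a c y)).card = 2 ^ (n - W.card) := by
  haveI := F4.nontrivial
  have e : failSetOf (fW W a c y) =
      univ.filter fun v : Fin (n - W.card) → Bool => ¬ ringWinU c y (ext W a v) = true := by
    unfold failSetOf fW
    refine filter_congr fun v _ => ?_
    rw [tr_stratFun]
    unfold ιF
    cases ringWinU c y (ext W a v) <;> simp
  rw [e, card_filter_add_card_filter_not, card_univ, Fintype.card_fun, Fintype.card_bool,
    Fintype.card_fin]

/-- **Hardness on the free cube**: with `c, m₀` of `failSet_ge_of_mem_fullSpan`, for `n − |W| ≥ m₀` and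
`D ≤ ⌊√(n − |W|)⌋`, a walk strategy whose cut tables are degree-`≤ D` in the free bits wins on at most
`(1 − c)·2^{n−|W|}` free patterns of the subcube `{u_W = a_W}`. -/
theorem card_win_ext_le {c₀ : ℝ} {m₀ : ℕ}
    (hcore : ∀ m ≥ m₀, ∀ D : ℕ, D ≤ Nat.sqrt m →
      ∀ f : (Fin m → Bool) → F4, f ∈ fullSpan m D → c₀ * (2 : ℝ) ^ m ≤ ((failSetOf f).card : ℝ))
    {D : ℕ} (hm : m₀ ≤ n - W.card) (hD : D ≤ Nat.sqrt (n - W.card))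
    (c : ℕ) (y : Fin (n + 1) → (Fin n → Bool) → Bool)
    (hy : ∀ g, HasDeg (fun u => y g (subcubeMerge W a u)) D) :
    ((univ.filter fun v : Fin (n - W.card) → Bool => ringWinU c y (ext W a v) = true).card : ℝ)
      ≤ (1 - c₀) * (2 : ℝ) ^ (n - W.card) := by
  have h1 := hcore (n - W.card) hm D hD (fW W a c y) (fW_mem_fullSpan W a c y hy)
  have h2 := card_win_add_card_fail W a c y
  have h2R : ((univ.filter fun v : Fin (n - W.card) → Bool => ringWinU c y (ext W a v) = true).card : ℝ)
      + ((failSetOf (fW W a c y)).card : ℝ) = (2 : ℝ) ^ (n - W.card) := by exact_mod_cast h2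
  linarith

/-! ### 4. Counting over the full cube (multiplicity `2^{|W|}`) -/

/-- Each fibre of the restriction map has at most `2^{|W|}` points. -/
theorem card_fibre_le (v : Fin (n - W.card) → Bool) (s : Finset (Fin n → Bool)) :
    (s.filter fun u => res W u = v).card ≤ 2 ^ W.card := by
  have key : (s.filter fun u => res W u = v).card ≤ (univ : Finset ({i // i ∈ W} → Bool)).card := by
    refine card_le_card_of_injOn (fun u => fun i : {i // i ∈ W} => u i.1) (fun _ _ => mem_univ _) ?_
    intro u₁ hu₁ u₂ hu₂ heq
    rw [Finset.mem_coe, mem_filter] at hu₁ hu₂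
    funext i
    by_cases hi : i ∈ W
    · exact congrFun heq ⟨i, hi⟩
    · have h1 := congrFun hu₁.2 (idx W i hi)
      have h2 := congrFun hu₂.2 (idx W i hi)
      unfold res at h1 h2
      rw [emb_idx] at h1 h2
      rw [h1, h2]
  rw [card_univ, Fintype.card_fun, Fintype.card_bool, Fintype.card_coe] at key
  exact key

/-- **Multiplicity count**: a property of the merged point holds for at most `2^{|W|}` times as many points
of the full cube as free patterns. -/
theorem card_filter_merge_le (P : (Fin n → Bool) → Prop) [DecidablePred P] :
    (univ.filter fun u : Fin n → Bool => P (subcubeMerge W a u)).card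
      ≤ 2 ^ W.card * (univ.filter fun v : Fin (n - W.card) → Bool => P (ext W a v)).card := by
  have e1 : (univ.filter fun u : Fin n → Bool => P (subcubeMerge W a u))
      = univ.filter fun u : Fin n → Bool => P (ext W a (res W u)) := by
    refine filter_congr fun u _ => ?_
    rw [merge_eq_ext_res]
  rw [e1]
  set s := univ.filter fun u : Fin n → Bool => P (ext W a (res W u)) with hs
  set t := univ.filter fun v : Fin (n - W.card) → Bool => P (ext W a v) with ht
  have hmaps : ∀ u ∈ s, res W u ∈ t := by
    intro u hu
    rw [hs, mem_filter] at hu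
    rw [ht, mem_filter]
    exact ⟨mem_univ _, hu.2⟩
  rw [card_eq_sum_card_fiberwise hmaps]
  calc ∑ v ∈ t, (s.filter fun u => res W u = v).card
      ≤ ∑ _v ∈ t, 2 ^ W.card := sum_le_sum fun v _ => card_fibre_le W v s
    _ = 2 ^ W.card * t.card := by rw [sum_const, smul_eq_mul, mul_comm]

/-- `|W| + (n − |W|) = n`. -/
theorem card_add_sub : W.card + (n - W.card) = n := by
  have h : W.card ≤ n := by
    calc W.card ≤ (univ : Finset (Fin n)).card := card_le_univ W
      _ = n := by rw [card_univ, Fintype.card_fin]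
  omega

end Subcube

/-! ### 5. `WalkHardAllSubcube δ₀` for every `δ₀ < 1` -/

/-- `√x / 2 ≤ ⌊√x⌋` for `x ≥ 4`. -/
private theorem half_sqrt_le_natSqrt {x : ℕ} (hx : 4 ≤ x) : Real.sqrt x / 2 ≤ (Nat.sqrt x : ℝ) := by
  have h4 : (4 : ℝ) ≤ x := by exact_mod_cast hx
  have hs4 : Real.sqrt 4 = 2 := by
    rw [show (4 : ℝ) = 2 ^ 2 by norm_num, Real.sqrt_sq (by norm_num)]
  have hs2 : (2 : ℝ) ≤ Real.sqrt x := by rw [← hs4]; exact Real.sqrt_le_sqrt h4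
  have h2 : Real.sqrt (x : ℝ) ≤ Nat.sqrt x + 1 := Real.real_sqrt_le_nat_sqrt_succ
  linarith

open Subcube in
/-- **`WalkHardAllSubcube δ₀` for every `δ₀ < 1`, unconditionally** — same `θ = 1 − c` as `WalkHardAll`
(`c` from `failSet_ge_of_mem_fullSpan`), `n₀ = n₀(C, δ₀)`: for `n ≥ n₀` and `|W| ≤ δ₀n` the free cube has
`n − |W| ≥ (1 − δ₀)n ≥ max(m₀, 4)` coordinates and `(log₂ n)^C ≤ √(1−δ₀)·√n / 2 ≤ ⌊√(n − |W|)⌋`. -/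
theorem walkHardAllSubcube {δ₀ : ℝ} (hδ₀ : δ₀ < 1) : WalkHardAllSubcube δ₀ := by
  obtain ⟨c, hc, m₀, hcore⟩ := failSet_ge_of_mem_fullSpan
  refine ⟨1 - c, by linarith, fun C => ?_⟩
  set β : ℝ := 1 - δ₀ with hβ
  have hβ0 : 0 < β := by rw [hβ]; linarith
  obtain ⟨n₁, hn₁⟩ := logPow_le_sqrt' C (c₀ := Real.sqrt β / 2) (by positivity)
  set M : ℕ := max m₀ 4 with hM
  refine ⟨max n₁ ⌈(M : ℝ) / β⌉₊, fun n hn ch W a hW y hy => ?_⟩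
  have hn₁n : n₁ ≤ n := le_trans (le_max_left _ _) hn
  have hnM : ⌈(M : ℝ) / β⌉₊ ≤ n := le_trans (le_max_right _ _) hn
  -- the size of the free cube
  set n' := n - W.card with hn'
  have hWn : W.card + n' = n := card_add_sub W
  have hn'R : β * n ≤ (n' : ℝ) := by
    have e : (n' : ℝ) = n - W.card := by
      have : (W.card : ℝ) + n' = n := by exact_mod_cast hWn
      linarith
    rw [e, hβ]
    nlinarith
  have hMn' : (M : ℝ) ≤ n' := by
    have h1 : (M : ℝ) / β ≤ n := le_trans (Nat.le_ceil _) (by exact_mod_cast hnM)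
    have h2 : (M : ℝ) ≤ β * n := by
      rw [div_le_iff₀ hβ0] at h1
      linarith
    linarith
  have hMn'ℕ : M ≤ n' := by exact_mod_cast hMn'
  have hm₀ : m₀ ≤ n' := le_trans (le_max_left _ _) hMn'ℕ
  have h4 : 4 ≤ n' := le_trans (le_max_right _ _) hMn'ℕ
  -- the degree fits under `⌊√n'⌋`
  have hD : (Nat.log 2 n) ^ C ≤ Nat.sqrt n' := by
    have h1 := hn₁ n hn₁n
    have h2 : Real.sqrt β / 2 * Real.sqrt n ≤ Real.sqrt n' / 2 := by
      rw [div_mul_eq_mul_div, ← Real.sqrt_mul hβ0.le]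
      have : Real.sqrt (β * n) ≤ Real.sqrt n' := Real.sqrt_le_sqrt hn'R
      linarith
    have h3 := half_sqrt_le_natSqrt h4
    have h4' : (((Nat.log 2 n) ^ C : ℕ) : ℝ) ≤ Nat.sqrt n' := by linarith
    exact_mod_cast h4'
  -- hardness on the free cube, then multiplicity
  have hfree := card_win_ext_le W a hcore hm₀ hD ch y hy
  have hmult := card_filter_merge_le W a (fun u => ringWinU ch y u = true)
  have hmultR : ((univ.filter fun u : Fin n → Bool => ringWinU ch y (subcubeMerge W a u) = true).card : ℝ)
      ≤ (2 : ℝ) ^ W.card *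
        ((univ.filter fun v : Fin n' → Bool => ringWinU ch y (ext W a v) = true).card : ℝ) := by
    exact_mod_cast hmult
  have hpow : (2 : ℝ) ^ W.card * (2 : ℝ) ^ n' = (2 : ℝ) ^ n := by
    rw [← pow_add, hWn]
  have h1c : 0 ≤ 1 - c := by
    -- `c ≤ 1`: apply the core bound to `f = 0 ∈ M_0(P_{n'})`, whose fail set is everything
    have h0 := hcore n' hm₀ 0 (Nat.zero_le _) 0 (Submodule.zero_mem _)
    have hle : ((failSetOf (0 : (Fin n' → Bool) → F4)).card : ℝ) ≤ (2 : ℝ) ^ n' := by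
      have : (failSetOf (0 : (Fin n' → Bool) → F4)).card ≤ (univ : Finset (Fin n' → Bool)).card :=
        card_le_univ _
      rw [card_univ, Fintype.card_fun, Fintype.card_bool, Fintype.card_fin] at this
      exact_mod_cast this
    have h2n : (0 : ℝ) < (2 : ℝ) ^ n' := by positivity
    nlinarith
  calc ((univ.filter fun u : Fin n → Bool => ringWinU ch y (subcubeMerge W a u) = true).card : ℝ)
      ≤ (2 : ℝ) ^ W.card *
          ((univ.filter fun v : Fin n' → Bool => ringWinU ch y (ext W a v) = true).card : ℝ) := hmultR
    _ ≤ (2 : ℝ) ^ W.card * ((1 - c) * (2 : ℝ) ^ n') :=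
        mul_le_mul_of_nonneg_left hfree (by positivity)
    _ = (1 - c) * (2 : ℝ) ^ n := by rw [← hpow]; ring

end Summit.QuantumAdvantage.AdviceFreeQNC0

end
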